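/-
Copyright: the b2b-balaban cell (near-miss cell 7), T⁴-continuum fan-out, lineage t4-ne7b-p3 (node U5c LARGE-DEVIATION
member P3).  Released under the licence of the surrounding project.
-/
import Mathlib.Analysis.SpecificLimits.Basic
import Summits.QuantumFields.BalabanUV.T4Continuum.Support.SpaceTimeLifetime

/-!
# Space-time Peierls ∕ Cramér route for NE7b — leaf A3b, second half: VOLUME ACCOUNTING OF A LINEAGE'S CONTOUR from
# the decaying size profile of its history tree (`|𝒦| ≤ C₁·fat + C₂·(epochLen + births)` on the (ID) carrier)

Summits-side support leaf of the T⁴-continuum cell (rung (B)+1 on a FINITE torus only; NOT infinite volume, NOT the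
mass gap, NOT the Clay statement; NOT a proof of the spine estimate NE7b).  Lineage `t4-ne7b-p3` (generation 2), node
U5c, skeleton `t4/skeletons/NE7b-t4-ne7b-p3.md` leaf A3b (volume accounting), row ST5.  [folklore] finite sums and real
arithmetic over the row's SHARED genealogy carrier `T4PersistenceDictionary.Gen` (lineage t4-ne7b-p1), imported BY NAME
and not modified; nothing is quoted from print and nothing printed is asserted; no `[cite:]` tag.

WHAT.  The volume of the contour `𝒦` of a lineage with genealogy `G` is the sum, over the structure-steps `(V, n)` of
the history tree of `G` (file `SpaceTimeLifetime`), of the number of cells the structure `V` occupies at step `n`.  The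
skeleton's READING A2b (displayed, not proved here) bounds that number by `cA · D_n(V) + cB`, where `D_n(V)` is the
MODELLED SIZE PROFILE of the structure: every constituent region born at step `s` with fatness class `d′` contributes
`d′ · 2^{−(n−s)}` from its birth on, every merger at step `s` a connector of class `dC` decaying likewise — the
dictionary's reading of the halving of sizes along event-free steps and of the subadditivity of sizes at mergers (the
same reading as the decaying size cost `T4PrintedShapeBanking.sz`), and `cB` per structure-step is the one cell a
small connected domain still occupies (`#cubes ≤ 2^d(4·d′ + 1)` for a connected family).  This file proves the
resulting VOLUME ACCOUNTING in the ledger form the route consumes (`SpaceTimePeierlsLeaves.ContourLedger.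
VolumeAccounting`):
* §1 the decay weight `decay s n = 𝟙_{s ≤ n} 2^{−(n−s)}` and `Σ_{n ∈ S} decay s n ≤ 2` over ANY finite set of steps;
* §2 the modelled size profile `Dfun fat step dC G n` of a structure and its TREE SUM `treeD … G t` over the
  structure-steps up to the cut `t` (the enumeration of `treeSteps`); `sum_Dfun_le`: over any set of steps the profile
  of `G` sums to `≤ 2·(fatSum + dC·#mergers)`; `treeD_le_sum`: the tree sum is at most the profile of the FINAL
  structure summed over `[rootStep, t)` (a renewal keeps the profile, a merger's profile dominates both partners');
* §3 **`volumeAccounting_ledgerOfGen`**: the displayed cell binder `vol ≤ cA·treeD G t + cB·treeSteps G t` at a cut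
  `t ≤ reach`, the located side conditions and well-formedness give
  `VolumeAccounting (2cA) (cB + 2cA·dC)` of the genealogy's ledger: `vol ≤ 2cA·fat + (cB + 2cA·dC)·(epochLen + births)`
  (lifetime `≤ epochLen` by `treeSteps_le_epochLen`, `#mergers + 1 = #births`); §3 also gives the dictionary instance.
So leaf A3b is KERNEL modulo the one displayed binder (the per-structure-step cell bound of the occupancy reading); the
S-halving geometry behind that binder is the carrier's (not decided here).

HONEST DEPENDENCY (cell, verbatim): continuum YM on T⁴ ⇐ BetaPertH ∧ nine spine estimates (0/9 proved); BetaPertH ⇐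
(D1) ∧ (D4) ∧ CAP+tail; G-an2-4 gates asym, D1 and NE2/3/4.  This file changes none of it.
-/

open Finset

namespace Summit.QuantumFields.BalabanUV.T4Continuum.SpaceTimePeierls

open Literature.MathematicalPhysics.QuantumFieldTheory.Balaban1983to89
open T4PersistenceDictionary T4BankedInduction SpaceTimePeierlsLeaves

noncomputable section

/-! ## §1 The decay weight -/

section Decay

/-- **THE DECAY WEIGHT** of a size created at step `s`, seen at step `n`: `2^{−(n−s)}` from `s` on, `0` before. [folklore] -/
def decay (s n : ℕ) : ℝ := if s ≤ n then (1 / 2 : ℝ) ^ (n - s) else 0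

/-- the decay weight is nonnegative [folklore] -/
theorem decay_nonneg (s n : ℕ) : 0 ≤ decay s n := by
  unfold decay
  split_ifs <;> positivity

/-- **OVER ANY FINITE SET OF STEPS THE DECAY WEIGHTS SUM TO AT MOST `2`** (`Σ_{k ≥ 0} 2^{−k} = 2`). [folklore] -/
theorem sum_decay_le_two (s : ℕ) (S : Finset ℕ) : ∑ n ∈ S, decay s n ≤ 2 := by
  set M := S.sup id with hM
  have hS : S ⊆ Finset.range (s + M + 1) := fun n hn => by
    have h : id n ≤ M := Finset.le_sup (f := id) hn
    rw [Finset.mem_range]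
    simp only [id] at h
    omega
  have h1 : ∑ n ∈ Finset.Ico 0 s, decay s n = 0 :=
    Finset.sum_eq_zero fun n hn => by
      rw [Finset.mem_Ico] at hn
      unfold decay
      rw [if_neg (by omega)]
  have h2 : ∑ n ∈ Finset.Ico s (s + M + 1), decay s n = ∑ k ∈ Finset.range (M + 1), (1 / 2 : ℝ) ^ k := by
    rw [Finset.sum_Ico_eq_sum_range, show s + M + 1 - s = M + 1 by omega]
    refine Finset.sum_congr rfl fun k _ => ?_
    unfold decay
    rw [if_pos (by omega), Nat.add_sub_cancel_left]
  calc ∑ n ∈ S, decay s n ≤ ∑ n ∈ Finset.range (s + M + 1), decay s n :=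
        Finset.sum_le_sum_of_subset_of_nonneg hS fun n _ _ => decay_nonneg s n
    _ = ∑ n ∈ Finset.Ico 0 s, decay s n + ∑ n ∈ Finset.Ico s (s + M + 1), decay s n := by
        rw [Finset.range_eq_Ico, Finset.sum_Ico_consecutive _ (Nat.zero_le s) (by omega)]
    _ ≤ 2 := by
        rw [h1, h2, zero_add]
        exact sum_geometric_two_le _

end Decay

/-! ## §2 The modelled size profile of a structure and its tree sum -/

section Profile

variable {ε : Type*}

/-- **THE MODELLED SIZE PROFILE** `D_n` of the structure described by a genealogy, at step `n`: a region of fatness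
class `fat b` born at `j` contributes `fat b · 2^{−(n−j)}` from its birth on; a renewal changes nothing (the renewed
component is the same domain); a merger adds the partners' profiles and a CONNECTOR of class `dC` decaying from the
merger step `step e` on.  (The dictionary's reading of the halving of sizes and of their subadditivity at mergers; the
identification with the realised tree lengths is the skeleton's displayed READING A2b.) [folklore] -/
def Dfun (fat : ε → ℕ) (step : ε → ℕ) (dC : ℝ) : Gen ε → ℕ → ℝ
  | Gen.born b j, n => (fat b : ℝ) * decay j n
  | Gen.renew G _ _, n => Dfun fat step dC G n
  | Gen.merge X Y e, n => Dfun fat step dC X n + Dfun fat step dC Y n + dC * decay (step e) n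

/-- **THE TREE SUM OF THE PROFILE** up to the cut `t`: the profile of every structure of the history tree summed over
its own segment (bare region: `[j, t)`; renewed component: the old tree up to `min (h+1) t`, then `[h+1, t)`; merged
component: both partner trees up to `min (step e) t`, then `[step e, t)`) — the same enumeration as `treeSteps` and as
`T4PrintedShapeBanking.treeCost`. [folklore] -/
def treeD (fat : ε → ℕ) (step : ε → ℕ) (dC : ℝ) : Gen ε → ℕ → ℝ
  | Gen.born b j, t => ∑ n ∈ Finset.Ico j t, Dfun fat step dC (Gen.born b j) n
  | Gen.renew G e h, t => treeD fat step dC G (min (h + 1) t) +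
      ∑ n ∈ Finset.Ico (h + 1) t, Dfun fat step dC (Gen.renew G e h) n
  | Gen.merge X Y e, t => treeD fat step dC X (min (step e) t) + treeD fat step dC Y (min (step e) t) +
      ∑ n ∈ Finset.Ico (step e) t, Dfun fat step dC (Gen.merge X Y e) n

variable {fat : ε → ℕ} {step : ε → ℕ} {dC : ℝ}

/-- the profile is nonnegative [folklore] -/
theorem Dfun_nonneg (hdC : 0 ≤ dC) : ∀ (G : Gen ε) (n : ℕ), 0 ≤ Dfun fat step dC G n
  | Gen.born b j, n => by
      simp only [Dfun]
      exact mul_nonneg (Nat.cast_nonneg _) (decay_nonneg _ _)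
  | Gen.renew G _ _, n => by
      simp only [Dfun]
      exact Dfun_nonneg hdC G n
  | Gen.merge X Y e, n => by
      simp only [Dfun]
      exact add_nonneg (add_nonneg (Dfun_nonneg hdC X n) (Dfun_nonneg hdC Y n))
        (mul_nonneg hdC (decay_nonneg _ _))

/-- **OVER ANY SET OF STEPS THE PROFILE SUMS TO AT MOST TWICE THE CREATED SIZE**:
`Σ_{n ∈ S} D_n(G) ≤ 2·(fatSum G + dC·#mergers G)` (each constituent's and each connector's decay weights sum to `≤ 2`).
[folklore] -/
theorem sum_Dfun_le (hdC : 0 ≤ dC) : ∀ (G : Gen ε) (S : Finset ℕ),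
    ∑ n ∈ S, Dfun fat step dC G n ≤ 2 * ((fatSum fat G : ℝ) + dC * nMerges G)
  | Gen.born b j, S => by
      simp only [Dfun, fatSum, nMerges, Nat.cast_zero, mul_zero, add_zero]
      rw [← Finset.mul_sum]
      have h := sum_decay_le_two j S
      have h0 : (0 : ℝ) ≤ fat b := Nat.cast_nonneg _
      nlinarith
  | Gen.renew G e h, S => by
      simp only [Dfun, fatSum, nMerges]
      exact sum_Dfun_le hdC G S
  | Gen.merge X Y e, S => by
      simp only [Dfun, fatSum, nMerges, Finset.sum_add_distrib, Nat.cast_add, Nat.cast_one]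
      have hX := sum_Dfun_le hdC X S
      have hY := sum_Dfun_le hdC Y S
      have hc : ∑ n ∈ S, dC * decay (step e) n ≤ dC * 2 := by
        rw [← Finset.mul_sum]
        exact mul_le_mul_of_nonneg_left (sum_decay_le_two (step e) S) hdC
      linarith

/-- **THE TREE SUM IS AT MOST THE FINAL PROFILE SUMMED OVER `[rootStep, t)`**: under the located side conditions
(`StepsOK`: the renewal step follows the root birth, the merger step follows both partners' root births) the segments of
the tree are disjoint sub-intervals of `[rootStep, t)`, a renewal keeps the profile, and the merged profile dominates
each partner's. [folklore] -/
theorem treeD_le_sum (hdC : 0 ≤ dC) {W : ε → ℕ} :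
    ∀ {G : Gen ε}, StepsOK step W G → ∀ t : ℕ,
      treeD fat step dC G t ≤ ∑ n ∈ Finset.Ico G.rootStep t, Dfun fat step dC G n
  | Gen.born b j, _, t => by simp only [treeD, Gen.rootStep_born]; exact le_rfl
  | Gen.renew G e h, hok, t => by
      simp only [StepsOK] at hok
      obtain ⟨hG, hrh, -⟩ := hok
      have IH := treeD_le_sum hdC hG (min (h + 1) t)
      have hD : ∀ n, Dfun fat step dC (Gen.renew G e h) n = Dfun fat step dC G n := fun n => by simp only [Dfun]
      simp only [treeD, Gen.rootStep_renew, hD]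
      rcases le_total t (h + 1) with ht | ht
      · rw [min_eq_right ht] at IH
        rw [Finset.Ico_eq_empty_of_le ht, Finset.sum_empty, add_zero, min_eq_right ht]
        exact IH
      · rw [min_eq_left ht] at IH
        rw [min_eq_left ht, ← Finset.sum_Ico_consecutive _ (show G.rootStep ≤ h + 1 by omega) ht]
        linarith
  | Gen.merge X Y e, hok, t => by
      simp only [StepsOK] at hok
      obtain ⟨hX, hY, hx, -, hy, -⟩ := hok
      have IHX := treeD_le_sum hdC hX (min (step e) t)
      have IHY := treeD_le_sum hdC hY (min (step e) t)
      have hD : ∀ n, Dfun fat step dC (Gen.merge X Y e) n =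
          Dfun fat step dC X n + Dfun fat step dC Y n + dC * decay (step e) n := fun n => by simp only [Dfun]
      simp only [treeD, Gen.rootStep_merge, hD]
      set r := min X.rootStep Y.rootStep with hr
      have hrs : r ≤ step e := (min_le_left _ _).trans hx
      -- the partners' sums extend to the common range `[r, min (step e) t)`
      have eX : ∑ n ∈ Finset.Ico X.rootStep (min (step e) t), Dfun fat step dC X n ≤
          ∑ n ∈ Finset.Ico r (min (step e) t), Dfun fat step dC X n :=
        Finset.sum_le_sum_of_subset_of_nonneg (Finset.Ico_subset_Ico_left (min_le_left _ _))
          fun n _ _ => Dfun_nonneg hdC X n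
      have eY : ∑ n ∈ Finset.Ico Y.rootStep (min (step e) t), Dfun fat step dC Y n ≤
          ∑ n ∈ Finset.Ico r (min (step e) t), Dfun fat step dC Y n :=
        Finset.sum_le_sum_of_subset_of_nonneg (Finset.Ico_subset_Ico_left (min_le_right _ _))
          fun n _ _ => Dfun_nonneg hdC Y n
      have eC : 0 ≤ ∑ n ∈ Finset.Ico r (min (step e) t), dC * decay (step e) n :=
        Finset.sum_nonneg fun n _ => mul_nonneg hdC (decay_nonneg _ _)
      rcases le_total t (step e) with ht | ht
      · rw [min_eq_right ht] at IHX IHY eX eY eC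
        rw [min_eq_right ht, Finset.Ico_eq_empty_of_le ht, Finset.sum_empty, add_zero]
        simp only [Finset.sum_add_distrib]
        linarith
      · rw [min_eq_left ht] at IHX IHY eX eY eC
        rw [min_eq_left ht, ← Finset.sum_Ico_consecutive _ hrs ht]
        simp only [Finset.sum_add_distrib]
        linarith

/-- the tree sum is nonnegative [folklore] -/
theorem treeD_nonneg (hdC : 0 ≤ dC) : ∀ (G : Gen ε) (t : ℕ), 0 ≤ treeD fat step dC G t
  | Gen.born b j, t => by
      simp only [treeD]
      exact Finset.sum_nonneg fun n _ => Dfun_nonneg hdC _ n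
  | Gen.renew G e h, t => by
      simp only [treeD]
      exact add_nonneg (treeD_nonneg hdC G _) (Finset.sum_nonneg fun n _ => Dfun_nonneg hdC _ n)
  | Gen.merge X Y e, t => by
      simp only [treeD]
      exact add_nonneg (add_nonneg (treeD_nonneg hdC X _) (treeD_nonneg hdC Y _))
        (Finset.sum_nonneg fun n _ => Dfun_nonneg hdC _ n)

end Profile

/-! ## §3 Volume accounting of the genealogy's ledger -/

section Volume

variable {ε : Type*} [DecidableEq ε]

/-- **LEAF A3b ON THE CARRIER — VOLUME ACCOUNTING.**  If the contour volume obeys the displayed cell binder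
`vol ≤ cA · treeD G t + cB · treeSteps G t` at a cut `t ≤ reach` (the occupancy reading: every structure-step `(V, n)`
of the lineage occupies at most `cA·D_n(V) + cB` cells), then along a genealogy satisfying the located side conditions
and well-formed, the ledger `ledgerOfGen` (fat `:= fatSum`) satisfies
`VolumeAccounting (2cA) (cB + 2cA·dC)`: `vol ≤ 2cA·fat + (cB + 2cA·dC)·(epochLen + births)` — the size part by
`treeD_le_sum` ∧ `sum_Dfun_le` (`#mergers < #births`), the lifetime part by `treeSteps_le_epochLen`. [folklore] -/
theorem volumeAccounting_ledgerOfGen {step : ε → ℕ} {W : ε → ℕ} {cost : Gen ε → ℕ → ℝ} {credit : ε → ℝ}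
    {fat : ε → ℕ} {cA cB dC : ℝ} (hcA : 0 ≤ cA) (hcB : 0 ≤ cB) (hdC : 0 ≤ dC)
    {G : Gen ε} (hok : StepsOK step W G) (hW : G.WF W) {t : ℕ} (ht : t ≤ G.reach W) {vol : ℕ}
    (hvol : (vol : ℝ) ≤ cA * treeD fat step dC G t + cB * treeSteps step G t) :
    (ledgerOfGen W cost credit vol (fatSum fat G) G).VolumeAccounting (2 * cA) (cB + 2 * cA * dC) := by
  have h1 : treeD fat step dC G t ≤ 2 * ((fatSum fat G : ℝ) + dC * nMerges G) :=
    (treeD_le_sum hdC hok t).trans (sum_Dfun_le hdC G _)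
  have h2 : (treeSteps step G t : ℝ) ≤ ((∑ e ∈ G.events, W e : ℕ) : ℝ) := by
    exact_mod_cast treeSteps_le_epochLen hok hW ht
  have h3 : (nMerges G : ℝ) ≤ nBirths G := by
    have := nMerges_add_one G
    exact_mod_cast (by omega : nMerges G ≤ nBirths G)
  have hE : (0 : ℝ) ≤ ((∑ e ∈ G.events, W e : ℕ) : ℝ) := Nat.cast_nonneg _
  have hB : (0 : ℝ) ≤ nBirths G := Nat.cast_nonneg _
  have k1 : cA * treeD fat step dC G t ≤ cA * (2 * ((fatSum fat G : ℝ) + dC * nMerges G)) :=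
    mul_le_mul_of_nonneg_left h1 hcA
  have k2 : cB * (treeSteps step G t : ℝ) ≤ cB * ((∑ e ∈ G.events, W e : ℕ) : ℝ) :=
    mul_le_mul_of_nonneg_left h2 hcB
  have k3 : cA * dC * (nMerges G : ℝ) ≤ cA * dC * nBirths G :=
    mul_le_mul_of_nonneg_left h3 (mul_nonneg hcA hdC)
  have k4 : 0 ≤ cA * dC * ((∑ e ∈ G.events, W e : ℕ) : ℝ) := mul_nonneg (mul_nonneg hcA hdC) hE
  have k5 : 0 ≤ cB * (nBirths G : ℝ) := mul_nonneg hcB hB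
  show (vol : ℝ) ≤ 2 * cA * ((fatSum fat G : ℕ) : ℝ) +
      (cB + 2 * cA * dC) * ((((∑ e ∈ G.events, W e : ℕ)) : ℝ) + ((nBirths G : ℕ) : ℝ))
  nlinarith [hvol, k1, k2, k3, k4, k5]

open T4PrintedShapeBanking in
/-- **ON THE DICTIONARY**: for a `Consistent` well-formed genealogy of persistence events (fatness `PEv.fat`, merger
step `PEv.step`), the displayed cell binder at a cut `t ≤ reach` gives `VolumeAccounting (2cA) (cB + 2cA·dC)` of its
ledger. [folklore] -/
theorem volumeAccounting_of_consistent {C : T4PrintedShapeBanking.Consts} {K : ℕ} {R : ℕ → ℕ}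
    {cost : Gen PEv → ℕ → ℝ} {credit : PEv → ℝ} {cA cB dC : ℝ} (hcA : 0 ≤ cA) (hcB : 0 ≤ cB) (hdC : 0 ≤ dC)
    {G : Gen PEv} (hc : Consistent C K R G) (hW : G.WF (dictW R C.n₁)) {t : ℕ}
    (ht : t ≤ G.reach (dictW R C.n₁)) {vol : ℕ}
    (hvol : (vol : ℝ) ≤ cA * treeD PEv.fat PEv.step dC G t + cB * treeSteps PEv.step G t) :
    (ledgerOfGen (dictW R C.n₁) cost credit vol (fatSum PEv.fat G) G).VolumeAccounting (2 * cA)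
      (cB + 2 * cA * dC) :=
  volumeAccounting_ledgerOfGen hcA hcB hdC (stepsOK_of_consistent hc hW) hW ht hvol

end Volume

end

end Summit.QuantumFields.BalabanUV.T4Continuum.SpaceTimePeierls
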